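import Literature.MathematicalPhysics.QuantumFieldTheory.Balaban1983to89.Node00.OpsYSectEElim

/-!
# `Balaban1983to89.B9PinMemberStarSupportSeparation` — T. Bałaban, *Propagators for lattice gauge theories in a background field*, Commun. Math. Phys. **99**
# (1985) 389–434 [Balaban1985BackgroundPropagators] p. 427 *«Λ ⊂ Λ_k = Ω_k^{(k)} is a union of big blocks, and a distance between Λ and Λ_kᶜ is bigger than RM»*
# with [Balaban1984PropagatorsII] (2.2) p. 224, AT NODE 00's UNIT LATTICE: **a unit block NEXT TO a good block lies in `Ω_k^{(k)}`** — so a top-level index bond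
# with a good source OR target block (print's STAR variables of (3.156), [4] (2.3) «at least one end-point») has its SOURCE in `Ω_k^{(k)}` (where def-Y's
# source-based readings `readUY ∕ idxOfU ∕ Q1Y` see it)

statement-level companion of published sources with citation tags; every declaration here is a theorem; nothing here is a claim about the Yang–Mills mass gap.

WHY THIS FILE (cell `pub-ymgap`, D-0062; seat dag-n08-b gen 36, INTENT-17a = dag-n08-d's OFFER-94 path, node00-def-Y's import-direction request: member geometry
only, imports `Node00.OpsYSectEElim`, NO door ∕ N08 file — so both `…PrecisionDoorGamma0AtOneStar` (n08-b) and node00-def-Y's announced star edition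
`Node00/OpsYSectEElimStar` can import it).  CHECK-L ∕ WORD-L (pub-ymgap bus 2026-08-29): print's Sect. E variables are the bonds with AT LEAST ONE end block in
`Λ′`; def-Y's carriers read bond functions at unit bonds SOURCED in `Ω_k^{(k)}`; the two meet because of (2.2): a block adjacent to `Λ′` is top-level.  This file
proves that sentence from `MemberY.hΛsep` (torus distance from `Λ` to every site of level `< k` exceeds `R·M·Lᵏ` fine units) and the torus metric of
`B4TorusKernel` (`torusSupNorm`, `circAbs`).

WHAT IS PROVED (0 `sorry`, 0 `def`, standard axioms; member `x : MemberY …`).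
* `circAbs_toBox_sub_lt` — for fine sites `z` over `u + e_μ` and `x′` over `u`, every coordinate of `toBox z − toBox x′` is at torus distance `< 2·Lᵏ` from `N₀ℤ`
  (`val_iterBlockOf`; the wrap-around coordinate through `circAbs_add_mul`, `N₀ = Lᵏ · sitesPerDir k`);
* ★★ `mem_Om_of_goodY_shift` — **`GoodY (u + e_μ) → u ∈ Ω_k^{(k)}`** (`iterBlockOf_mem_domT_iff` at `x′ = embIter k u`; else `hΛsep` would give
  `R·M·L^{k+1} < torusSupNorm < 2Lᵏ`, against `R ≥ 2L²`, `M_h ≥ 8`);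
* ★ `usrc_mem_Om_of_star` — a top-level index bond with a good source or target block has `usrc ∈ Ω_k^{(k)}`;
* ★ `starSupport_imp_starOmSupport` — the interim STAR support «`lvl q = k ∧ (GoodY (usrc q) ∨ GoodY (utgt q))`» implies the `Ω_k`-sourced form
  «`lvl q = k ∧ (GoodY (usrc q) ∨ (usrc q ∈ Ω_k^{(k)} ∧ GoodY (utgt q)))`» read by `…PrecisionDoorGamma0AtOne.scalarRow_starOm`.

HONEST SCOPE.  Count-neutral member geometry; nothing of (3.156)'s analysis; node N06 ∕ N08 NOT discharged; nothing continuum ∕ OS ∕ mass gap ∕ Clay.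
-/

noncomputable section

namespace Literature.MathematicalPhysics.QuantumFieldTheory.Balaban1983to89.B9PinMemberStarSupportSeparation

open Literature.MathematicalPhysics.QuantumFieldTheory
open Literature.MathematicalPhysics.QuantumFieldTheory.Balaban1983to89.Node00
open B9PinMembersKLevelV1 (MemberY)
open B6GlobalChartV1 (PV domT toBox toBox_apply iterBlockOf_mem_domT_iff)
open B6MultiLevelBoxOperator (N0 bigSide)
open B6Ineq2142KLevelV1 (lvl)
open B5Eq118OneStroke (iterBlockOf val_iterBlockOf)
open B15DeterminingSets (embIter)
open B4TorusKernel.MultiPeriod (torusSupNorm circAbs circAbs_le_abs circAbs_add_mul)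

variable {d ℓ : ℕ} {hd : 1 ≤ d + 1} {hL : Odd (ℓ + 1) ∧ 1 < ℓ + 1} {b₀ b₁ : ℝ} {Mstar : ℕ}
variable (x : MemberY d ℓ hd hL b₀ b₁ Mstar)


/-- two naturals in consecutive `P`-blocks differ by less than `2P`. [folklore] -/
private theorem natAbs_sub_lt_of_div {a b P q : ℕ} (hP : 0 < P) (ha : a / P = q + 1) (hb : b / P = q) :
    0 ≤ (a : ℤ) - b ∧ (a : ℤ) - b < 2 * P := by
  have ha1 := Nat.div_add_mod a P
  have ha2 := Nat.mod_lt a hP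
  have hb1 := Nat.div_add_mod b P
  have hb2 := Nat.mod_lt b hP
  rw [ha] at ha1; rw [hb] at hb1
  have e1 : P * (q + 1) = P * q + P := by ring
  rw [e1] at ha1
  constructor
  · have : b ≤ a := by omega
    omega
  · have : a < b + 2 * P := by omega
    omega

/-- two naturals in the same `P`-block differ by less than `P`. [folklore] -/
private theorem abs_sub_lt_of_div_eq {a b P q : ℕ} (hP : 0 < P) (ha : a / P = q) (hb : b / P = q) : |(a : ℤ) - b| < P := by
  have ha1 := Nat.div_add_mod a P
  have ha2 := Nat.mod_lt a hP
  have hb1 := Nat.div_add_mod b P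
  have hb2 := Nat.mod_lt b hP
  rw [ha] at ha1; rw [hb] at hb1
  rw [abs_lt]
  constructor <;> omega

/-- for fine sites `z` over `u + e_μ` and `x′` over `u`, every coordinate of `toBox z − toBox x′` is at torus distance `< 2·Lᵏ` from `N₀ℤ` (the `μ`-th
coordinate may wrap around the period `N₀ = Lᵏ · sitesPerDir k`). [cite: Balaban1984PropagatorsII, (2.2) p.224; Balaban1985BackgroundPropagators, p.427, bookkeeping] -/
theorem circAbs_toBox_sub_lt (u : USiteY x) (μ : Fin (d + 1)) {z x' : Site (PV d ℓ x.m x.K hd hL) 0}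
    (hz : iterBlockOf x.k z = u.shift μ) (hx' : iterBlockOf x.k x' = u) (i : Fin (d + 1)) :
    (circAbs (N0 ℓ x.Mh x.k x.P' i) (((toBox x.hN z).1 - (toBox x.hN x').1) i) : ℤ) < 2 * (ℓ + 1) ^ x.k := by
  have hP : 0 < (ℓ + 1) ^ x.k := pow_pos (Nat.succ_pos ℓ) _
  have hN1 : 1 ≤ N0 ℓ x.Mh x.k x.P' i := by rw [x.hN i]; exact Nat.one_le_iff_ne_zero.mpr ((PV d ℓ x.m x.K hd hL).sitesPerDir_ne_zero 0)
  have hqz : (z i).val / (ℓ + 1) ^ x.k = ((u.shift μ) i).val := by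
    rw [← val_iterBlockOf x.k x.hk z i, hz]
  have hqx : (x' i).val / (ℓ + 1) ^ x.k = (u i).val := by
    rw [← val_iterBlockOf x.k x.hk x' i, hx']
  have hcoord : ((toBox x.hN z).1 - (toBox x.hN x').1) i = ((z i).val : ℤ) - (x' i).val := by
    rw [Pi.sub_apply]; rfl
  rw [hcoord]
  by_cases hi : i = μ
  · subst hi
    -- the shifted coordinate: `(u + e_i) i = u i + 1` in `ℤ ∕ (sitesPerDir k)`
    have hshift : (u.shift i) i = u i + 1 := by simp [Site.shift]
    rw [hshift, ZMod.val_add, ZMod.val_one] at hqz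
    set n := (PV d ℓ x.m x.K hd hL).sitesPerDir x.k with hn
    have hun : (u i).val < n := ZMod.val_lt (u i)
    by_cases hwrap : (u i).val + 1 < n
    · rw [Nat.mod_eq_of_lt hwrap] at hqz
      obtain ⟨h0, h1⟩ := natAbs_sub_lt_of_div hP hqz hqx
      calc (circAbs (N0 ℓ x.Mh x.k x.P' i) (((z i).val : ℤ) - (x' i).val) : ℤ) ≤ |((z i).val : ℤ) - (x' i).val| :=
            circAbs_le_abs hN1 _
        _ < 2 * (ℓ + 1) ^ x.k := by rw [abs_of_nonneg h0]; exact_mod_cast h1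
    · -- wrap-around: `u i = n − 1`, the shifted quotient is `0`
      have hval : (u i).val + 1 = n := by omega
      rw [hval, Nat.mod_self] at hqz
      -- `z i < P`, `x' i ≥ (n-1)·P`, and the torus identifies modulo `N = n·P`
      have hN : N0 ℓ x.Mh x.k x.P' i = n * (ℓ + 1) ^ x.k := by
        rw [x.hN i, hn, B6AgreeQaQV1Chart.sitesPerDir_zero_eq_mul (PV d ℓ x.m x.K hd hL) x.hk, mul_comm]
      have hz1 := Nat.div_add_mod (z i).val ((ℓ + 1) ^ x.k)
      have hz2 := Nat.mod_lt (z i).val hP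
      have hx1 := Nat.div_add_mod (x' i).val ((ℓ + 1) ^ x.k)
      have hx2 := Nat.mod_lt (x' i).val hP
      rw [hqz] at hz1; rw [hqx] at hx1
      have hzlt : (z i).val < (ℓ + 1) ^ x.k := by omega
      have hxge : (n - 1) * (ℓ + 1) ^ x.k ≤ (x' i).val := by
        have : (u i).val = n - 1 := by omega
        rw [← this, mul_comm]; exact le_of_le_of_eq (Nat.le_add_right _ _) hx1
      have hxlt : (x' i).val < n * (ℓ + 1) ^ x.k := by
        have : (u i).val + 1 ≤ n := hun
        nlinarith
      have key : circAbs (N0 ℓ x.Mh x.k x.P' i) (((z i).val : ℤ) - (x' i).val) =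
          circAbs (N0 ℓ x.Mh x.k x.P' i) (((z i).val : ℤ) - (x' i).val + (N0 ℓ x.Mh x.k x.P' i : ℕ) * 1) :=
        (circAbs_add_mul _ _ 1).symm
      rw [key]
      have h0 : 0 ≤ ((z i).val : ℤ) - (x' i).val + (N0 ℓ x.Mh x.k x.P' i : ℕ) * 1 := by
        rw [hN]; push_cast; nlinarith
      have h1 : ((z i).val : ℤ) - (x' i).val + (N0 ℓ x.Mh x.k x.P' i : ℕ) * 1 < 2 * (ℓ + 1) ^ x.k := by
        rw [hN]; push_cast
        have hn1 : 1 ≤ n := by omega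
        have e : ((n : ℤ) - 1 + 1) = n := by ring
        have hxge' : ((n : ℤ) - 1) * (ℓ + 1) ^ x.k ≤ (x' i).val := by
          have := hxge
          zify [hn1] at this
          exact_mod_cast this
        nlinarith
      calc (circAbs (N0 ℓ x.Mh x.k x.P' i) (((z i).val : ℤ) - (x' i).val + (N0 ℓ x.Mh x.k x.P' i : ℕ) * 1) : ℤ)
          ≤ |((z i).val : ℤ) - (x' i).val + (N0 ℓ x.Mh x.k x.P' i : ℕ) * 1| := circAbs_le_abs hN1 _
        _ < 2 * (ℓ + 1) ^ x.k := by rw [abs_of_nonneg h0]; exact h1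
  · have hshift : (u.shift μ) i = u i := by simp [Site.shift, Function.update_of_ne hi]
    rw [hshift] at hqz
    calc (circAbs (N0 ℓ x.Mh x.k x.P' i) (((z i).val : ℤ) - (x' i).val) : ℤ) ≤ |((z i).val : ℤ) - (x' i).val| :=
          circAbs_le_abs hN1 _
      _ < (ℓ + 1) ^ x.k := by exact_mod_cast abs_sub_lt_of_div_eq hP hqz hqx
      _ ≤ 2 * (ℓ + 1) ^ x.k := by exact_mod_cast Nat.le_mul_of_pos_left _ two_pos

/-- ★★ **A UNIT BLOCK NEXT TO A GOOD BLOCK LIES IN `Ω_k^{(k)}`**: `GoodY (u + e_μ) → u ∈ Ω_k^{(k)}` — otherwise a fine site of level `< k` over `u` would be at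
torus distance `< 2·Lᵏ ≤ R·M·L^{k+1}` from a site of `Λ`, against p. 427 ∕ (2.2) (`MemberY.hΛsep`).
[cite: Balaban1985BackgroundPropagators, p.427 («a distance between Λ and Λ_kᶜ is bigger than RM»); Balaban1984PropagatorsII, (2.2) p.224] -/
theorem mem_Om_of_goodY_shift (u : USiteY x) (μ : Fin (d + 1)) (hg : GoodY x (u.shift μ)) :
    u ∈ (domT x.hN x.D x.hk).Om x.k := by
  set x' : Site (PV d ℓ x.m x.K hd hL) 0 := embIter x.k u with hx'def
  have hx' : iterBlockOf x.k x' = u := iterBlockOf_embIter x.k x.hk u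
  rw [← hx', iterBlockOf_mem_domT_iff x.hN x.D x.hk (one_le_k x) le_rfl]
  by_contra hlt
  push Not at hlt
  obtain ⟨z, hzΛ, hz⟩ := hg (u.shift μ) rfl
  have hsep := x.hΛsep z hzΛ x' hlt
  -- the torus distance between the two blocks is `< 2·Lᵏ`
  have hbound : torusSupNorm (N0 ℓ x.Mh x.k x.P') ((toBox x.hN z).1 - (toBox x.hN x').1) < 2 * (((ℓ + 1 : ℕ) : ℝ)) ^ x.k := by
    unfold torusSupNorm
    rw [Finset.sup'_lt_iff]
    intro i _
    exact_mod_cast circAbs_toBox_sub_lt x u μ hz hx' i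
  -- while `R·M·L^{k+1} ≥ 2·Lᵏ`
  have hRM : 2 * (((ℓ + 1 : ℕ) : ℝ)) ^ x.k ≤ ((x.R * bigSide ℓ x.Mh x.k : ℕ) : ℝ) := by
    have hR : 2 ≤ x.R := le_trans (by nlinarith [Nat.succ_pos ℓ]) x.hR2
    have hM : 1 ≤ x.Mh := le_trans (by norm_num) x.hM8
    have h : 2 * (ℓ + 1) ^ x.k ≤ x.R * bigSide ℓ x.Mh x.k := by
      unfold bigSide
      calc 2 * (ℓ + 1) ^ x.k ≤ x.R * (1 * ((ℓ + 1) ^ x.k * 1)) := by rw [one_mul, mul_one]; exact Nat.mul_le_mul_right _ hR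
        _ ≤ x.R * (x.Mh * ((ℓ + 1) ^ x.k * (ℓ + 1))) :=
            Nat.mul_le_mul_left _ (Nat.mul_le_mul hM (Nat.mul_le_mul_left _ (Nat.succ_pos ℓ)))
        _ = x.R * (x.Mh * (ℓ + 1) ^ (x.k + 1)) := by rw [pow_succ]
    exact_mod_cast h
  linarith

/-- ★ a top-level index bond with a good SOURCE or TARGET block has its source in `Ω_k^{(k)}` (so def-Y's source-based reading `readUY` sees it).
[cite: Balaban1985BackgroundPropagators, p.427; Balaban1984PropagatorsII, (2.3) p.224] -/
theorem usrc_mem_Om_of_star (q : IBondY x.toKIdx) (hq : lvl x.hN x.D x.hk q = x.k) (hg : GoodY x (usrc x q) ∨ GoodY x (utgt x q)) :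
    usrc x q ∈ (domT x.hN x.D x.hk).Om x.k := by
  rcases hg with hg | hg
  · exact mem_Om_of_good x hg rfl
  · obtain ⟨⟨j, b⟩, hb⟩ := q
    have hj : j = Fin.last x.k := Fin.ext hq
    subst hj
    have es : usrc x ⟨⟨Fin.last x.k, b⟩, hb⟩ = b.src := iterBlockOf_embIter x.k x.hk _
    have et : utgt x ⟨⟨Fin.last x.k, b⟩, hb⟩ = b.tgt := iterBlockOf_embIter x.k x.hk _
    rw [es]
    rw [et] at hg
    exact mem_Om_of_goodY_shift x b.src b.dir hg


/-- ★ **THE INTERIM STAR SUPPORT IS `Ω_k`-SOURCED**: «`lvl q = k ∧ (GoodY (usrc q) ∨ GoodY (utgt q))`» (dag-n08-d `…_of_scalarRow_star`, node00-def-Y WORD-L) implies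
«`lvl q = k ∧ (GoodY (usrc q) ∨ (usrc q ∈ Ω_k^{(k)} ∧ GoodY (utgt q)))`» (dag-n08-b `…PrecisionDoorGamma0AtOne.scalarRow_starOm`).
[cite: Balaban1985BackgroundPropagators, p.427, (3.156) p.428; Balaban1984PropagatorsII, (2.2)–(2.3) p.224] -/
theorem starSupport_imp_starOmSupport (q : IBondY x.toKIdx) (h : lvl x.hN x.D x.hk q = x.k ∧ (GoodY x (usrc x q) ∨ GoodY x (utgt x q))) :
    lvl x.hN x.D x.hk q = x.k ∧ (GoodY x (usrc x q) ∨ (usrc x q ∈ (domT x.hN x.D x.hk).Om x.k ∧ GoodY x (utgt x q))) :=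
  ⟨h.1, h.2.elim Or.inl fun hg => Or.inr ⟨usrc_mem_Om_of_star x q h.1 (Or.inr hg), hg⟩⟩

end Literature.MathematicalPhysics.QuantumFieldTheory.Balaban1983to89.B9PinMemberStarSupportSeparation

end
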